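import Summits.CriticalPhenomena.PercolationContinuityZ3.Theses.PercLupuEnvironment
import Literature.MathematicalPhysics.QuantumFieldTheory.CurvatureGaussianField
import HarnessLib

/-!
# `PercLupuEnvironment.GFFExists` (stmt-CriticalPhenomena-6992) PROVED — the discrete GFF of `ℤ³` exists

Item `stmt-CriticalPhenomena-6992` of route `CriticalPhenomena/PercLupuEnvironment` (support #9): some probability space
carries a centred Gaussian process `(g_x)_{x ∈ ℤ³}` with `E g_x g_y = latticeGreen(x − y)/2` (the massless lattice
Green function of `−Δ`, i.e. `(−L)⁻¹`).

Proof.  The tree already holds the general construction (Kolmogorov extension of the consistent centred multivariate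
Gaussians of a positive semidefinite kernel): `Literature.MathematicalPhysics.QuantumFieldTheory.gaussianFieldOfKernel`
with `isGaussianProcess_eval_gaussianFieldOfKernel`, `integral_eval_gaussianFieldOfKernel` (centred) and
`covariance_eval_gaussianFieldOfKernel` (covariance = kernel), and the Fourier positivity of the Green function,
`sum_sum_mul_mul_half_latticeGreen_nonneg` (`d ≥ 3`).  We check that `K(x, y) := latticeGreen(x − y)/2` is a positive
semidefinite kernel on `Site 3` (symmetry from `latticeGreen_neg`), take `Ω := Site 3 → ℝ`, `P := gaussianFieldOfKernel K`,
`g x ω := ω x`, and convert covariance + zero mean into the second moment (`covariance_eq_sub`, coordinates are in `L²`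
by `HasGaussianLaw.memLp`).  No definitions, no sorries; valid at every `p` (no percolation input).

builds on p205010 (kernel theorem, internal audit signed; external expert review pending) — lane bookkeeping only; this
file does not use continuity.  RSW3 lane, prover P2 gen 32 (prover-prim-rsw3-p2-g32-0).
References: O. Kallenberg, *Foundations of Modern Probability* (2002), Lemma 13.1 / Thm. 6.16 [Kallenberg2002];
T. Lupu, Ann. Probab. 44 (2016) [doi:10.1214/15-aop1019].
-/

noncomputable section

namespace Summit.CriticalPhenomena.PercolationContinuityZ3.Theorems

namespace LupuEnvironmentGFFExists

open MeasureTheory ProbabilityTheory Literature.Probability.LatticeModels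
  Literature.MathematicalPhysics.QuantumFieldTheory
open scoped Matrix

/-- `K(x, y) = latticeGreen(x − y)/2` is a positive semidefinite kernel on `ℤ³`: symmetric (`latticeGreen` is even) and
`∑ᵢⱼ cᵢ cⱼ K(xᵢ, xⱼ) ≥ 0` by the Fourier representation of the Green function
(`sum_sum_mul_mul_half_latticeGreen_nonneg`). [folklore] -/
theorem isPosSemidefKernel_halfLatticeGreen :
    IsPosSemidefKernel (fun x y : Site 3 => latticeGreen (x - y) / 2) := by
  intro I
  refine Matrix.PosSemidef.of_dotProduct_mulVec_nonneg (Matrix.IsHermitian.ext fun s t => ?_) fun x => ?_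
  · simp only [covGram_apply, star_trivial]
    rw [show ((t : Site 3) - (s : Site 3) : Site 3) = -((s : Site 3) - (t : Site 3)) by abel, latticeGreen_neg]
  · rw [star_trivial]
    have h := sum_sum_mul_mul_half_latticeGreen_nonneg (d := 3) le_rfl I (fun s : I => (s : Site 3)) x
    have expand : x ⬝ᵥ (covGram (fun x y : Site 3 => latticeGreen (x - y) / 2) I *ᵥ x) =
        ∑ j : I, ∑ j' : I, x j * x j' * (latticeGreen ((j : Site 3) - (j' : Site 3)) / 2) := by
      simp only [dotProduct, Matrix.mulVec, covGram_apply, Finset.mul_sum]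
      refine Finset.sum_congr rfl fun s _ => Finset.sum_congr rfl fun t _ => ?_
      ring
    rw [expand]
    exact h

/-- **`PercLupuEnvironment.GFFExists` (stmt-CriticalPhenomena-6992).**  The discrete Gaussian free field of `ℤ³` with unit
conductances exists: on `Ω = (Site 3 → ℝ, gaussianFieldOfKernel K)` the coordinate process is a centred Gaussian process
with `E g_x g_y = latticeGreen(x − y)/2`. [cite: Kallenberg2002, Lemma 13.1 / Thm. 6.16] -/
theorem gffExists_proof : Summit.CriticalPhenomena.PercolationContinuityZ3.Theses.PercLupuEnvironment.GFFExists := by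
  set K : Site 3 → Site 3 → ℝ := fun x y => latticeGreen (x - y) / 2 with hKdef
  have hK : IsPosSemidefKernel K := isPosSemidefKernel_halfLatticeGreen
  haveI := isProbabilityMeasure_gaussianFieldOfKernel hK
  refine ⟨Site 3 → ℝ, inferInstance, gaussianFieldOfKernel K, isProbabilityMeasure_gaussianFieldOfKernel hK,
    fun x ω => ω x, isGaussianProcess_eval_gaussianFieldOfKernel hK, integral_eval_gaussianFieldOfKernel hK,
    fun x y => ?_⟩
  have h2 : ∀ s : Site 3, MemLp (fun ω : Site 3 → ℝ => ω s) 2 (gaussianFieldOfKernel K) := fun s =>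
    ((isGaussianProcess_eval_gaussianFieldOfKernel hK).hasGaussianLaw_eval s).memLp (by norm_num)
  have h := covariance_eq_sub (μ := gaussianFieldOfKernel K) (h2 x) (h2 y)
  rw [covariance_eval_gaussianFieldOfKernel hK, integral_eval_gaussianFieldOfKernel hK x, zero_mul, sub_zero] at h
  have h' : ∫ ω, ω x * ω y ∂gaussianFieldOfKernel K = K x y := by
    rw [h]
    rfl
  exact h'

end LupuEnvironmentGFFExists

end Summit.CriticalPhenomena.PercolationContinuityZ3.Theorems

end
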